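import Summits.BirchSwinnertonDyer.Rank1Residual.X11b.KolyvaginReductionDatum
import HarnessLib

/-!
# T1 JET (cell `bsd-jet`), road K, gap `htr` — BRICK B2 (reduction): the reduction
# `E(K̄) → Ẽ(𝔽̄_ℓ)` at a prime `𝔓 ∣ λ` of `\bar ℤ_K`, inertia-invariant, injective on prime-to-`ℓ`
# torsion, carrying EVERY Frobenius power `g ≡ x ↦ x^{ℓ^j} (mod 𝔓)` to `φ^j`

HONEST FRAMING (programme file §HONESTY, verbatim): «no tranche here proves BSD; ARM L moves the
LITERAL column of an r ≤ 1 census into the kernel-proved-modulo-named-print column.» THEOREMS ONLY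
(seat `bsd-jet-pv-2`, session g5; `--supports stmt-BirchSwinnertonDyer-14418`, helper); 0 classes
move. WHAT THIS IS. x11b3's `KolyvaginH44.exists_reductionDatum` (McCallum 1991, proof of Prop. 4.4)
packages the reduction map along a prime `𝔓 ∣ λ` for ONE arithmetic Frobenius `F` (`red ∘ F =
φ² ∘ red`) together with the `±`-eigen structure it needs. The transverse gap `htr` (Howard 2004,
Lemma 2.7.3: the Kolyvagin class at a prime `ℓ ∣ c` is split by `K[ℓ]_{λ'}`) needs the same map with
a Frobenius clause for EVERY element acting as `x ↦ x^{ℓ^j}` modulo `𝔓` (the Frobenius elements of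
the decomposition group lying in `Γ_{K[c]}` are obtained by an inertial correction and are not the
`F` of the datum), and no eigen structure. This file re-runs x11b3's transport
(`geomReduction_conj_datum` along `E(K̄) ≃ E(ℚ̄)`, `RatClosure.pointsEquiv`) with that clause:
`exists_kolyvaginReduction` — for `W/ℚ` globally minimal with `ℓ ∤ Δ_W`, a place `v ∋ ℓ` of `K`
which is the only place above `ℓ`, `𝔓 ∣ v`: there is `red : E(K̄) →+ Ẽ(𝔽̄_ℓ)`, onto, with
`red (τ • x) = red x` for `τ ∈ I_𝔓` (AEC VII.4.1 / Serre 1972 §1.11), `red (g • x) = φ^j • red x`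
whenever `g • z ≡ z^{ℓ^j} (mod 𝔓)` on `\bar ℤ_K` (`g = ι h^j` with `ι ∈ I_𝔓` and `h` a Frobenius of `ℚ`),
and `red` injective on the `n`-torsion for `ℓ ∤ n` (AEC VII.3.1 (b)). References:
[cite: McCallumLMS1991, Prop. 4.4 (proof)] [cite: Howard2004HeegnerKolyvagin, Lemma 2.7.3]
[cite: SilvermanAEC2009, Prop. VII.2.1, VII.3.1(b)] [cite: Serre1972, §1.11].
-/

set_option autoImplicit false

noncomputable section

open scoped Classical Pointwise

open WeierstrassCurve Field NumberField IsDedekindDomain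
  Literature.NumberTheory.EllipticCurves Literature.NumberTheory.GaloisRepresentations
  Rat.HeightOneSpectrum Summit.BirchSwinnertonDyer.Rank1Residual.X11b

universe u

namespace Summit.BirchSwinnertonDyer.Rank1Residual.JET

variable {K : Type u} [Field K] [NumberField K] {ℓ : ℕ} [hℓ : Fact ℓ.Prime]
  (W : WeierstrassCurve ℚ) [W.IsGloballyMinimal] [W.IsElliptic]
  (hΔ : ¬ (ℓ : ℤ) ∣ minimalDiscriminantInt W)

include hΔ in
/-- **The reduction at `𝔓 ∣ λ` with the Frobenius clause for every Frobenius power.** For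
`E = W/ℚ` globally minimal with `ℓ ∤ Δ_W`, a number field `K`, a place `v ∋ ℓ` of `K` which is the
only place above `ℓ`, a prime `𝔓 ∣ v` of `\bar ℤ_K` and the `ℓ`-power Frobenius `φ₀` of `𝔽̄_ℓ`:
there is an additive `red : E(K̄) → Ẽ(𝔽̄_ℓ)`, onto, with (i) `red (τ • x) = red x` for every
`τ ∈ I_𝔓`; (ii) `red (g • x) = φ₀^j • red x` for every `g ∈ Γ_K` and `j` with
`g • z - z^{ℓ^j} ∈ 𝔓` for all `z ∈ \bar ℤ_K` (such `g` is `ι · h^j` with `ι ∈ I_{𝔓 ∩ \bar ℤ}` and `h` an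
arithmetic Frobenius of `ℚ`); (iii) an `n`-torsion point with `ℓ ∤ n` and `red x = 0` is `0`.
[cite: McCallumLMS1991, Prop. 4.4 (proof)] [cite: SilvermanAEC2009, Prop. VII.3.1(b)]
[cite: Serre1972, §1.11] -/
theorem exists_kolyvaginReduction {φ₀ : absoluteGaloisGroup (ZMod ℓ)}
    (hφ : ∀ x : AlgebraicClosure (ZMod ℓ), φ₀ • x = x ^ ℓ)
    {v : HeightOneSpectrum (𝓞 K)} (hv : (ℓ : 𝓞 K) ∈ v.asIdeal)
    (huniq : ∀ w : HeightOneSpectrum (𝓞 K), (ℓ : 𝓞 K) ∈ w.asIdeal → w = v)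
    {𝔓 : Ideal (absIntegers (𝓞 K) K)} (h𝔓 : 𝔓 ∈ v.primesAbove) :
    ∃ red : geomPoints (W.baseChange K) →+ (reductionModPrime W ℓ).geomPoints,
      Function.Surjective red ∧
      (∀ τ ∈ 𝔓.inertia (absoluteGaloisGroup K), ∀ x, red (τ • x) = red x) ∧
      (∀ (g : absoluteGaloisGroup K) (j : ℕ),
        (∀ z : absIntegers (𝓞 K) K, g • z - z ^ (ℓ ^ j) ∈ 𝔓) →
        ∀ x, red (g • x) = (φ₀ ^ j) • red x) ∧
      (∀ (n : ℕ), ¬ ℓ ∣ n → ∀ x, (n : ℤ) • x = 0 → red x = 0 → x = 0) := by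
  set θ := RatClosure.pointsEquiv (K := K) W with hθ
  -- the place `v₀ = (ℓ)` of `ℚ`, the prime `𝔓₀ = 𝔓 ∩ \bar ℤ`, the prime `𝔓pl` of the place
  obtain ⟨v₀, hv₀, hℓv₀⟩ := KolyvaginH44.exists_ratPlace ℓ
  haveI := v.isPrime
  have hw : v.asIdeal.under (𝓞 ℚ) = v₀.asIdeal :=
    Rat.under_eq_asIdeal_of_natCast_mem hℓ.out hℓv₀ hv
  set 𝔓₀ : Ideal (absIntegers (𝓞 ℚ) ℚ) := 𝔓.comap (absIntegersMap ℚ K) with h𝔓₀def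
  have h𝔓₀ : 𝔓₀ ∈ v₀.primesAbove := comap_absIntegersMap_mem_primesAbove hw h𝔓
  obtain ⟨𝔓pl, hmem, h𝔓pl⟩ := exists_ideal_placeOver ℓ hv₀
  -- a `g ∈ Γ_K` with `res g • 𝔓pl = 𝔓₀`
  obtain ⟨𝔔, w, h𝔔c, hwv₀, h𝔔w⟩ := exists_place_comap_eq_smul (M := K) h𝔓pl 1
  rw [one_smul] at h𝔔c
  have hwv : w = v := by
    refine huniq w ?_
    haveI := w.isPrime
    have : (ℓ : 𝓞 ℚ) ∈ w.asIdeal.under (𝓞 ℚ) := by rw [hwv₀]; exact hℓv₀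
    rw [Ideal.under_def, Ideal.mem_comap, map_natCast] at this
    exact this
  subst hwv
  obtain ⟨g, hg⟩ := HeightOneSpectrum.exists_smul_eq_of_mem_primesAbove_holds h𝔔w h𝔓
  have hδ : absGaloisRestrict ℚ K g • 𝔓pl = 𝔓₀ := by
    rw [← h𝔔c, ← comap_absIntegersMap_smul, hg]
  -- the reduction along `𝔓₀`
  obtain ⟨hI, hFr, hinj, hsurj⟩ := KolyvaginH44.geomReduction_conj_datum hΔ hv₀ hmem h𝔓pl hδ hφ
  set red₀ : W.geomPoints →+ (reductionModPrime W ℓ).geomPoints :=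
    (geomReduction hΔ).comp (DistribSMul.toAddMonoidHom W.geomPoints (absGaloisRestrict ℚ K g)⁻¹)
    with hred₀def
  set red : geomPoints (W.baseChange K) →+ (reductionModPrime W ℓ).geomPoints :=
    red₀.comp θ.symm.toAddMonoidHom with hreddef
  have hred : ∀ Q, red Q = red₀ (θ.symm Q) := fun Q ↦ rfl
  -- an arithmetic Frobenius of `ℚ` at `𝔓₀` and its powers
  obtain ⟨h', hh'⟩ := HeightOneSpectrum.exists_isArithFrobAt_of_mem_primesAbove_holds h𝔓₀
  have hq : v₀.residueCard = ℓ := by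
    rw [Rat.residueCard_eq_natGenerator]; exact hv₀
  have hpow : ∀ (j : ℕ) (x : absIntegers (𝓞 ℚ) ℚ), h' ^ j • x - x ^ (ℓ ^ j) ∈ 𝔓₀ := fun j x ↦ by
    have := smul_pow_sub_pow_mem_of_isArithFrobAt h𝔓₀ hh' j x
    rwa [hq] at this
  have hFrpow : ∀ (j : ℕ) (P : W.geomPoints), red₀ (h' ^ j • P) = (φ₀ ^ j) • red₀ P := by
    intro j
    induction j with
    | zero => intro P; rw [pow_zero, pow_zero, one_smul, one_smul]
    | succ j ih =>
      intro P
      rw [pow_succ', pow_succ', mul_smul, mul_smul, hFr h' hh', ih]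
  refine ⟨red, ?_, ?_, ?_, ?_⟩
  · -- onto
    intro b
    obtain ⟨P, hP⟩ := hsurj b
    exact ⟨θ P, by rw [hred, AddEquiv.symm_apply_apply]; exact hP⟩
  · -- inertia
    intro τ hτ x
    rw [hred, hred, KolyvaginH44.pointsEquiv_symm_smul]
    exact hI _ (absGaloisRestrict_mem_inertia_comap ℚ K hτ) _
  · -- Frobenius powers
    intro γ j hγ x
    have hγ' : ∀ x : absIntegers (𝓞 ℚ) ℚ, absGaloisRestrict ℚ K γ • x - x ^ (ℓ ^ j) ∈ 𝔓₀ :=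
      (forall_smul_sub_pow_mem_comap_iff ℚ K 𝔓 γ (ℓ ^ j)).mpr hγ
    set ι : absoluteGaloisGroup ℚ := absGaloisRestrict ℚ K γ * (h' ^ j)⁻¹ with hι
    have hιI : ι ∈ 𝔓₀.inertia (absoluteGaloisGroup ℚ) := by
      intro x
      change ι • x - x ∈ 𝔓₀
      set y := (h' ^ j)⁻¹ • x with hy
      have hx : x = h' ^ j • y := by rw [hy, smul_inv_smul]
      have h1 : ι • x = absGaloisRestrict ℚ K γ • y := by rw [hι, mul_smul]
      rw [h1, hx]
      have := sub_mem (hγ' y) (hpow j y)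
      rwa [sub_sub_sub_cancel_right] at this
    have hιh : ι * h' ^ j = absGaloisRestrict ℚ K γ := by
      rw [hι, mul_assoc, inv_mul_cancel, mul_one]
    rw [hred, hred, KolyvaginH44.pointsEquiv_symm_smul, ← hιh, mul_smul, hI ι hιI, hFrpow]
  · -- injective on `E[n]`, `ℓ ∤ n`
    intro n hn x hx h0
    rw [hred] at h0
    have hx' : n • θ.symm x = 0 := by rw [← natCast_zsmul, ← map_zsmul, hx, map_zero]
    have := hinj n hn _ hx' h0
    rw [← θ.symm.map_eq_zero_iff]
    exact this

end Summit.BirchSwinnertonDyer.Rank1Residual.JET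

end
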